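import Literature.Geometry.Lorentzian.CodazziEquationFrame
import Literature.Geometry.Lorentzian.TraceDerivativeFrame
import Literature.Geometry.Lorentzian.TracedGaussEquationGeneral
import HarnessLib

/-!
# The momentum constraint of hypersurface data from the Codazzi equation

For a spacelike immersed hypersurface `f : (Nᵐ, f^*g) → (Mᵐ⁺¹, g)` with a unit normal field `ν`
of sign `ε ≠ 0` and second fundamental form `K(v, w) = g(D_v ν, df w)` (the tree's
`secondFundamentalForm`), the trace of the Codazzi equation
(`codazzi_equation_localFrame`, `CodazziEquationFrame.lean`; O'Neill 1983, Ch. 4, Prop. 33) over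
an `(f^*g)`-orthogonal basis `βᵢ` of `T_{y₀}N` (`aᵢ = (f^*g)(βᵢ, βᵢ)`) gives

  `div K (v) − d(tr K)(v) = ∑ᵢ g(R̄(df βᵢ, df v) ν, df βᵢ)/aᵢ = Ric_g(df v, ν)`,

i.e. the **momentum constraint** `div_h k − d(tr_h k) = Ric_g(df ·, ν)` for the induced data
`(h, k) = (f^*g, K)` (`InitialDataSet.momentumConstraintFn`, `InitialData.lean`): the left-hand
side vanishes on a spacelike hypersurface of a Ricci-flat spacetime (Choquet-Bruhat 2009, Ch. VI,
(3.11) and Thm. 3.3; Wald 1984, (10.2.29); Bartnik–Isenberg 2004, (2.2)). Ingredients: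
`div K(β_d) = ∑ᵢ (∇_{βᵢ}K)(βᵢ, β_d)/aᵢ` (`divergence`, `trace_eq_sum_gram_inv`),
`d(tr K)(β_d) = ∑ᵢ (∇_{β_d}K)(βᵢ, βᵢ)/aᵢ` (`mdifferentiableAt_and_mvfderiv_trace_localFrame`,
`TraceDerivativeFrame.lean`), symmetry of `∇K` in its first two slots (`K` symmetric), Codazzi,
and `Ric(df β_d, ν) = ∑ᵢ g(R̄(df βᵢ, df β_d)ν, df βᵢ)/aᵢ` in the adapted frame
`(df β₀, …, df βₘ₋₁, ν)` (`ricci_eq_sum_of_isOrthoᵢ`, `val_riemann_self₃₄`).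

* `PseudoRiemannianMetric.covDeriv₂_symm₁₂` — `(∇_Z k)(X, Y) = (∇_Z k)(Y, X)` for a symmetric
  field `k` differentiable at the point;
* `PseudoRiemannianMetric.divergence_sub_mvfderiv_meanCurvature_eq_ricci` — **the momentum
  constraint identity** `div K(v) − d(tr K)(v) = Ric_g(df v, ν)` at `y₀`, for every `v ∈ T_{y₀}N`;
* `PseudoRiemannianMetric.divergence_sub_mvfderiv_meanCurvature_eq_zero` — vanishing when
  `Ric_g = 0` at `f y₀`.

Everything is proved; there are no definitions and no named facts.

## References

* Y. Choquet-Bruhat, *General Relativity and the Einstein Equations*, OUP 2009, Ch. VI, §3,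
  (3.11) and Thm. 3.3. [ChoquetBruhat2009]
* R. M. Wald, *General Relativity*, Chicago 1984, (10.2.24)–(10.2.30). [Wald1984]
* R. Bartnik, J. Isenberg, *The constraint equations*, Birkhäuser 2004, §2, (2.2).
  [BartnikIsenberg2004]
* B. O'Neill, *Semi-Riemannian geometry with applications to relativity*, Academic Press 1983,
  Ch. 3, p. 86 (divergence); Ch. 4, Prop. 33 (Codazzi equation). [ONeill1983]
-/

noncomputable section

open Bundle Set Filter Function Manifold
open scoped Manifold ContDiff Topology

namespace Literature.Geometry.Lorentzian

namespace PseudoRiemannianMetric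

variable {E : Type*} [NormedAddCommGroup E] [NormedSpace ℝ E] {H : Type*} [TopologicalSpace H]
  {I : ModelWithCorners ℝ E H} {M : Type*} [TopologicalSpace M] [ChartedSpace H M]
  [IsManifold I ∞ M] [FiniteDimensional ℝ E] [CompleteSpace E]
  (g : PseudoRiemannianMetric I ∞ E (TangentSpace I : M → Type _)) [g.HasLeviCivita]

/-! ### Symmetry of `∇k` in its first two slots -/

omit [CompleteSpace E] in
/-- **`(∇_Z k)(X, Y) = (∇_Z k)(Y, X)` for a symmetric field of bilinear forms** differentiable at
`x` (as a section of `Hom(TM, Hom(TM, ℝ))`): on extended vectors,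
`(∇_Z k)(X,Y) = Z(k(X,Y)) − k(∇_Z X, Y) − k(X, ∇_Z Y)` (`covDeriv₂_apply_extend`), which is
symmetric in `X ↔ Y` when `k` is. O'Neill 1983, Ch. 3, Def. 3.16–3.17.
[cite: ONeill1983, Ch. 3, Def. 3.17] -/
theorem covDeriv₂_symm₁₂ {x : M} {k : Π y : M, TangentSpace I y →L[ℝ] TangentSpace I y →L[ℝ] ℝ}
    (hks : ∀ (y : M) (v w : TangentSpace I y), k y v w = k y w v)
    (hk : MDifferentiableAt I (I.prod 𝓘(ℝ, E →L[ℝ] E →L[ℝ] ℝ))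
      (fun y ↦ TotalSpace.mk' (E →L[ℝ] E →L[ℝ] ℝ)
        (E := fun y : M ↦ TangentSpace I y →L[ℝ] TangentSpace I y →L[ℝ] ℝ) y (k y)) x)
    (X₀ Y₀ Z₀ : TangentSpace I x) :
    g.covDeriv₂ k x X₀ Y₀ Z₀ = g.covDeriv₂ k x Y₀ X₀ Z₀ := by
  rw [covDeriv₂_apply_extend hk X₀ Y₀ Z₀, covDeriv₂_apply_extend hk Y₀ X₀ Z₀]
  simp only [covDeriv₂Aux]
  have hfun : (fun y ↦ k y (FiberBundle.extend E X₀ y) (FiberBundle.extend E Y₀ y)) =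
      fun y ↦ k y (FiberBundle.extend E Y₀ y) (FiberBundle.extend E X₀ y) :=
    funext fun y ↦ hks y _ _
  rw [hfun, hks x (g.leviCivita (FiberBundle.extend E X₀) x (FiberBundle.extend E Z₀ x)),
    hks x (FiberBundle.extend E X₀ x)]
  ring

/-! ### The momentum constraint -/

section Momentum

variable {E' : Type*} [NormedAddCommGroup E'] [NormedSpace ℝ E'] {H' : Type*} [TopologicalSpace H']
  {I' : ModelWithCorners ℝ E' H'} {N : Type*} [TopologicalSpace N] [ChartedSpace H' N]
  [IsManifold I' ∞ N] [FiniteDimensional ℝ E'] [CompleteSpace E'] [I'.Boundaryless] {f : N → M}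
  (hpb : contMDiff_pullbackBilin I M I' N ∞) (hfi : g.IsSpacelikeImmersion I' f)
  {ν : NormalField I f} {ε : ℝ}

/-- **The momentum constraint identity** (traced Codazzi equation). For a smooth spacelike
immersion `f : (Nᵐ, f^*g) → (Mᵐ⁺¹, g)` with a unit normal field `ν` of sign `ε ≠ 0` (smooth lift
to `TM`), a field `Kc` of continuous bilinear forms on `TN` agreeing with the second fundamental
form `K = secondFundamentalForm` (`K(v, w) = g(D_v ν, df w)`) and differentiable at `y₀` as a
section of `Hom(TN, Hom(TN, ℝ))`, and every `v ∈ T_{y₀}N`: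
`(div_{f^*g} Kc)(v) − d(tr_{f^*g} K)(v) = Ric_g(df v, ν)` at `y₀`,
with `div` the metric divergence (`divergence`, trace over the derivative slot and the first
slot) and `tr K = meanCurvature`. Choquet-Bruhat 2009, Ch. VI, (3.11); Wald 1984, (10.2.29);
O'Neill 1983, Ch. 4, Prop. 33 traced. Proof: see the module docstring.
[cite: ChoquetBruhat2009, Ch. VI, (3.11)] -/
theorem divergence_sub_mvfderiv_meanCurvature_eq_ricci
    (hν : ContMDiff I' I.tangent ∞ (fun x ↦ (TotalSpace.mk' E (f x) (ν x) : TangentBundle I M)))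
    (hun : g.IsUnitNormal I' f ν ε) (hε : ε ≠ 0) {m : ℕ}
    (hm : Module.finrank ℝ E' = m) (hm1 : Module.finrank ℝ E = m + 1)
    (Kc : Π y : N, TangentSpace I' y →L[ℝ] TangentSpace I' y →L[ℝ] ℝ)
    (hKc : ∀ (y : N) (v w : TangentSpace I' y),
      Kc y v w = g.secondFundamentalForm I' f ν y v w)
    (y₀ : N)
    (hKd : MDifferentiableAt I' (I'.prod 𝓘(ℝ, E' →L[ℝ] E' →L[ℝ] ℝ))
      (fun y ↦ TotalSpace.mk' (E' →L[ℝ] E' →L[ℝ] ℝ)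
        (E := fun y : N ↦ TangentSpace I' y →L[ℝ] TangentSpace I' y →L[ℝ] ℝ) y (Kc y)) y₀)
    (v : TangentSpace I' y₀) :
    haveI := (g.inducedMetric f hpb hfi).hasLeviCivita
    (g.inducedMetric f hpb hfi).divergence Kc y₀ v -
        mvfderiv I' (g.meanCurvature f hpb hfi ν) y₀ v =
      g.ricci (f y₀) (mfderiv I' I f y₀ v) (ν y₀) := by
  haveI := (g.inducedMetric f hpb hfi).hasLeviCivita
  classical
  set gN := g.inducedMetric f hpb hfi with hgN
  have hdim : Module.finrank ℝ E = Module.finrank ℝ E' + 1 := by rw [hm, hm1]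
  have hf2 : ContMDiff I' I 2 f :=
    (IsSpacelikeImmersion.contMDiff_self hfi).of_le (by exact WithTop.coe_le_coe.2 le_top)
  -- symmetry of `K`
  have hKs : ∀ (y : N) (u w : TangentSpace I' y), Kc y u w = Kc y w u := fun y u w ↦ by
    rw [hKc, hKc]
    exact (secondFundamentalForm_symm_holds (g := g) (I' := I') hf2 hun.1
      (hν.of_le (by exact WithTop.coe_le_coe.2 le_top)) BoundarylessManifold.isInteriorPoint).eq u w
  -- an orthogonal basis `β` of `(T_{y₀} N, f^*g)` indexed by `Fin m`
  obtain ⟨e, he, hde⟩ := exists_isOrthoᵢ_basis gN y₀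
  have hfin : Module.finrank ℝ (TangentSpace I' y₀) = m := hm
  set β : Module.Basis (Fin m) ℝ (TangentSpace I' y₀) := e.reindex (finCongr hfin) with hβdef
  have hβapply : ∀ k, β k = e ((finCongr hfin).symm k) := fun k ↦ Module.Basis.reindex_apply _ _ _
  have hβ : (gN.toBilinForm y₀).IsOrthoᵢ β := by
    intro k l hkl
    simp only [Function.onFun, hβapply]
    exact he fun h ↦ hkl ((finCongr hfin).symm.injective h)
  have hdβ : ∀ k, gN.val y₀ (β k) (β k) ≠ 0 := fun k ↦ by
    rw [hβapply]; exact hde _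
  set a : Fin m → ℝ := fun i ↦ gN.val y₀ (β i) (β i) with ha
  -- the coordinate frame of the chart at `y₀` built on `β`, evaluated at `y₀`, is `β`
  have hself : ∀ i, (trivializationAt E' (TangentSpace I') y₀).localFrame β i y₀ = β i :=
    fun i ↦ localFrame_trivializationAt_self (I := I') β y₀ i
  have hselff : (fun i ↦ (trivializationAt E' (TangentSpace I') y₀).localFrame β i y₀) = ⇑β :=
    funext hself
  have hβf : (gN.toBilinForm y₀).IsOrthoᵢ
      fun i ↦ (trivializationAt E' (TangentSpace I') y₀).localFrame β i y₀ := by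
    rw [hselff]; exact hβ
  have hdβf : ∀ i, gN.val y₀ ((trivializationAt E' (TangentSpace I') y₀).localFrame β i y₀)
      ((trivializationAt E' (TangentSpace I') y₀).localFrame β i y₀) ≠ 0 := fun i ↦ by
    rw [hself]; exact hdβ i
  -- it suffices to prove the identity on the basis vectors `β d`
  suffices key : ∀ d : Fin m, gN.divergence Kc y₀ (β d) -
      mvfderiv I' (g.meanCurvature f hpb hfi ν) y₀ (β d) =
      g.ricci (f y₀) (mfderiv I' I f y₀ (β d)) (ν y₀) by
    set L : TangentSpace I' y₀ →ₗ[ℝ] ℝ := gN.divergence Kc y₀ -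
      (mvfderiv I' (g.meanCurvature f hpb hfi ν) y₀).toLinearMap with hL
    set R : TangentSpace I' y₀ →ₗ[ℝ] ℝ :=
      (g.ricci (f y₀)).flip (ν y₀) ∘ₗ (mfderiv I' I f y₀).toLinearMap with hR
    have hLR : L = R := β.ext fun d ↦ by
      simp only [hL, hR, LinearMap.sub_apply, ContinuousLinearMap.coe_coe, LinearMap.comp_apply,
        LinearMap.BilinForm.flip_apply]
      exact key d
    have h := congrArg (fun T : TangentSpace I' y₀ →ₗ[ℝ] ℝ ↦ T v) hLR
    simpa only [hL, hR, LinearMap.sub_apply, ContinuousLinearMap.coe_coe, LinearMap.comp_apply,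
      LinearMap.BilinForm.flip_apply] using h
  intro d
  -- (1) the divergence in the orthogonal frame
  have hdiv : gN.divergence Kc y₀ (β d) = ∑ i, gN.covDeriv₂ Kc y₀ (β i) (β d) (β i) / a i := by
    rw [divergence_apply, trace_eq_sum_gram_inv gN y₀ β, gram_inv_of_isOrthoᵢ gN y₀ β hβ hdβ]
    refine Finset.sum_congr rfl fun i _ ↦ ?_
    rw [Finset.sum_eq_single i]
    · rw [Matrix.diagonal_apply_eq, divergenceAux_apply, inv_mul_eq_div]
    · intro j _ hji
      rw [Matrix.diagonal_apply_ne _ hji, zero_mul]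
    · intro h
      exact absurd (Finset.mem_univ i) h
  -- (2) the differential of the mean curvature in the orthogonal frame
  have hmean : g.meanCurvature f hpb hfi ν = fun y ↦ gN.trace y (Kc y).toLinearMap₁₂ := by
    funext y
    have hK : (Kc y).toLinearMap₁₂ = g.secondFundamentalForm I' f ν y :=
      LinearMap.ext₂ fun u w ↦ hKc y u w
    rw [hK]
    rfl
  have htr := (gN.mdifferentiableAt_and_mvfderiv_trace_localFrame β hKd hβf hdβf d).2
  simp only [hself] at htr
  have hdtr : mvfderiv I' (g.meanCurvature f hpb hfi ν) y₀ (β d) =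
      ∑ i, gN.covDeriv₂ Kc y₀ (β i) (β i) (β d) / a i := by
    rw [hmean]
    exact htr
  -- (3) Codazzi on the triples `(i, d, i)`
  have hcod : ∀ i : Fin m, gN.covDeriv₂ Kc y₀ (β d) (β i) (β i) -
      gN.covDeriv₂ Kc y₀ (β i) (β i) (β d) =
      g.val (f y₀) (g.riemann (f y₀) (mfderiv I' I f y₀ (β i)) (mfderiv I' I f y₀ (β d)) (ν y₀))
        (mfderiv I' I f y₀ (β i)) := fun i ↦ by
    have h := codazzi_equation_localFrame g hpb hfi β hν hun hε hdim Kc hKc hKd i d i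
    simp only [hself] at h
    exact h
  -- (4) the Ricci tensor in the adapted orthogonal frame `(df β₀, …, df βₘ₋₁, ν)` of `T_{f y₀} M`
  have hn0 : ∀ k, g.val (f y₀) (mfderiv I' I f y₀ (β k)) (ν y₀) = 0 := fun k ↦ by
    rw [g.symm]; exact hun.1 y₀ (β k)
  have hνε : g.val (f y₀) (ν y₀) (ν y₀) = ε := hun.2 y₀
  set w : Fin (m + 1) → TangentSpace I (f y₀) :=
    Fin.snoc (α := fun _ ↦ TangentSpace I (f y₀)) (fun i ↦ mfderiv I' I f y₀ (β i)) (ν y₀)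
    with hw
  have hwc : ∀ i : Fin m, w i.castSucc = mfderiv I' I f y₀ (β i) := fun i ↦ by
    simp [hw]
  have hwl : w (Fin.last m) = ν y₀ := by simp [hw]
  have hwo : (g.toBilinForm (f y₀)).IsOrthoᵢ w := by
    intro k l hkl
    simp only [Function.onFun, toBilinForm_apply]
    induction k using Fin.lastCases with
    | last =>
      induction l using Fin.lastCases with
      | last => exact absurd rfl hkl
      | cast j => rw [hwl, hwc, g.symm]; exact hn0 j
    | cast i =>
      induction l using Fin.lastCases with
      | last => rw [hwl, hwc]; exact hn0 i
      | cast j =>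
        rw [hwc, hwc]
        exact hβ fun h ↦ hkl (by rw [h])
  have hwd : ∀ k, g.toBilinForm (f y₀) (w k) (w k) ≠ 0 := by
    intro k
    induction k using Fin.lastCases with
    | last => rw [toBilinForm_apply, hwl, hνε]; exact hε
    | cast i => rw [toBilinForm_apply, hwc]; exact hdβ i
  have hli : LinearIndependent ℝ w := LinearMap.linearIndependent_of_isOrthoᵢ hwo hwd
  haveI : FiniteDimensional ℝ (TangentSpace I (f y₀)) := inferInstanceAs (FiniteDimensional ℝ E)
  have hcard : Fintype.card (Fin (m + 1)) = Module.finrank ℝ (TangentSpace I (f y₀)) := by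
    show Fintype.card (Fin (m + 1)) = Module.finrank ℝ E
    rw [hm1, Fintype.card_fin]
  set γ := basisOfLinearIndependentOfCardEqFinrank hli hcard with hγdef
  have hγ : ∀ k, γ k = w k := fun k ↦
    congrFun (coe_basisOfLinearIndependentOfCardEqFinrank hli hcard) k
  have hγo : (g.toBilinForm (f y₀)).IsOrthoᵢ γ := by
    intro k l hkl
    simp only [Function.onFun, hγ]
    exact hwo hkl
  have hRic := ricci_eq_sum_of_isOrthoᵢ g (f y₀) γ hγo (fun k ↦ by rw [hγ]; exact hwd k)
    (mfderiv I' I f y₀ (β d)) (ν y₀)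
  rw [Fin.sum_univ_castSucc] at hRic
  simp only [hγ, hwc, hwl, hνε, val_riemann_self₃₄, zero_div, add_zero] at hRic
  -- (5) assemble
  rw [hdiv, hdtr, hRic, ← Finset.sum_sub_distrib]
  refine Finset.sum_congr rfl fun i _ ↦ ?_
  rw [← sub_div, gN.covDeriv₂_symm₁₂ hKs hKd (β i) (β d) (β i), hcod i]
  rfl

omit [CompleteSpace E] in
/-- **The momentum constraint of the data induced on a spacelike hypersurface of a vacuum
spacetime**: under the hypotheses of `divergence_sub_mvfderiv_meanCurvature_eq_ricci`, if
`Ric_g = 0` at `f y₀` then `(div K)(v) − d(tr K)(v) = 0` for all `v ∈ T_{y₀}N` — the momentum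
constraint equation for the induced data `(f^*g, K)`. Choquet-Bruhat 2009, Ch. VI, Thm. 3.3;
Bartnik–Isenberg 2004, (2.2) with `J = 0`. [cite: ChoquetBruhat2009, Ch. VI, Thm. 3.3] -/
theorem divergence_sub_mvfderiv_meanCurvature_eq_zero [CompleteSpace E]
    (hν : ContMDiff I' I.tangent ∞ (fun x ↦ (TotalSpace.mk' E (f x) (ν x) : TangentBundle I M)))
    (hun : g.IsUnitNormal I' f ν ε) (hε : ε ≠ 0) {m : ℕ}
    (hm : Module.finrank ℝ E' = m) (hm1 : Module.finrank ℝ E = m + 1)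
    (Kc : Π y : N, TangentSpace I' y →L[ℝ] TangentSpace I' y →L[ℝ] ℝ)
    (hKc : ∀ (y : N) (v w : TangentSpace I' y),
      Kc y v w = g.secondFundamentalForm I' f ν y v w)
    (y₀ : N)
    (hKd : MDifferentiableAt I' (I'.prod 𝓘(ℝ, E' →L[ℝ] E' →L[ℝ] ℝ))
      (fun y ↦ TotalSpace.mk' (E' →L[ℝ] E' →L[ℝ] ℝ)
        (E := fun y : N ↦ TangentSpace I' y →L[ℝ] TangentSpace I' y →L[ℝ] ℝ) y (Kc y)) y₀)
    (hRic : g.ricci (f y₀) = 0) (v : TangentSpace I' y₀) :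
    haveI := (g.inducedMetric f hpb hfi).hasLeviCivita
    (g.inducedMetric f hpb hfi).divergence Kc y₀ v -
        mvfderiv I' (g.meanCurvature f hpb hfi ν) y₀ v = 0 := by
  rw [g.divergence_sub_mvfderiv_meanCurvature_eq_ricci hpb hfi hν hun hε hm hm1 Kc hKc y₀ hKd v,
    hRic, LinearMap.zero_apply, LinearMap.zero_apply]

end Momentum

end PseudoRiemannianMetric

end Literature.Geometry.Lorentzian

end
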